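import Literature.MathematicalPhysics.QuantumFieldTheory.Balaban1983to89.B8LeafModelZd3H
import Literature.MathematicalPhysics.QuantumFieldTheory.Balaban1983to89.B8TowerBondsPrinted

/-!
# `Balaban1983to89.B8LeafModelZd3P` — NODE 00's [B8] carrier RE-TYPED IN ITS THREE CLASS-SENSITIVE LETTERS (additive, «deprecate-and-add»): `zdGF3P` =
# n05-a's `B8LeafModelZd3.zdGF3` with (α) the (1.37) ∕ (1.42) letter `C137` «Q_j(U₀, ηA) = B on Λ_j, |B| < 2dLα₁» read over PRINT'S CONSTRAINT-BOND CLASS of the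
# member's own tower — [Balaban1985RegularSpaces] (1.31) p. 82 INCLUDING the crossing contours «b₋ ∈ Λ_j, Γ_{b₋,x} ⊂ Λ_{j−1}», [Balaban1984PropagatorsII]
# (2.3) p. 224 — i.e. over dag-n05-d's `B8TowerBondsPrinted.towerBondsP L i.Ω (i.Λs i.k) j ⊇ i.Λb i.k j` instead of the member's law field `i.Λb` (law №12
# `towerBonds`: NO crossing bond), and (β) the (1.35) ∕ (1.66) letters `avgClose` ∕ `avgClose166` «|Ū′U₀ʲ − Ū₀ʲ| < α₁ on Λ_j ∕ on Ω_j^{(j)}» read in PRINT's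
# p. 77 ONE-END-POINT bond class «at least one end-point of b belongs to Ω_j^{(j)}» (block-wise: `Bʲ(z) ⊂ Ω_j` or `Bʲ(z + e_μ) ⊂ Ω_j`) instead of the tree's box
# form «`Bʲ(z) ∪ Bʲ(z + e_μ) ⊂ Ω_j`»; and `zdGF3HP` = the same with Theorem 8's source space as printed (n05-c's `zdGF3H` reading).  Every other field is
# `zdGF3`'s by `rfl`; each re-typed letter IMPLIES the old one (no converses).

statement-level skeleton of published theorems with citation tags; ONE PAIR of carrier definitions + `rfl` bookkeeping; nothing here is a claim about the
Yang–Mills mass gap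

T. Bałaban, *Spaces of regular gauge field configurations on a lattice and gauge fixing conditions*, Commun. Math. Phys. **99** (1985) 75–102
`[Balaban1985RegularSpaces]` ("B8"; journal page = PDF page + 74; PDF held `paper:balaban1985-cmp99-regular-spaces-gauge-fixing`): (1.31) p. 82 (the averaging
constraints for an inner bond `⟨x, x′⟩ ⊂ Λ_j` AND for a crossing bond, «All sites of the contours Γ_{b₋,x} belong to Λ_{j−1}»), (1.37) p. 82 «Q_j(U₀, ηA) = B on
Λ_j, |B| < 2dLα₁», (1.42) p. 83, (1.12) p. 78 «𝔅_k = ⋃_j Λ_j (the same for the sets of bonds)», p. 77 (bond convention), (1.35) p. 82, (1.66) p. 88, (1.145)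
p. 100, Thm 2 p. 83, Prop. 3 p. 87, Thm 4 p. 88, Thm 8 (1.146) p. 101.  T. Bałaban, *Propagators and renormalization transformations for lattice gauge
theories. II*, Commun. Math. Phys. **96** (1984) 223–250 `[Balaban1984PropagatorsII]` ("B6"), (2.3) p. 224.

## WHY THIS FILE (cell `pub-ymgap`, HUMAN RULING D-0062 ∕ D-0149; DAG node N05 = [B8]; width seat `pub-ymgap-dag-n05-w1` g0, pen HANDED by the row's
## -d lane dag-n05-d g10 (cell bus 2026-08-27 23:27Z); definition lane, count-neutral)

dag-n05-d's kernel certificate `B8Prop3ShellModeVacuity.not_b8LeafOfRecordSubBH` (p585094): [B8] PROPOSITION 3 AS TYPED on the record's carrier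
(`Node00.famB8OfRecordSubBH = zdGF3H ∘ val`, whose `GFData2` part is `zdGF3`'s) is FALSE at the lawful `k = 1` shell member, because `zdGF3.C137` reads the
(1.42) HYPOTHESIS of Proposition 3 on the member's own class `i.Λb = towerBonds …` — which, over every print-like tower, contains NO level-`j ≥ 1` crossing bond
(`B8Ineq159FlatCubeMemberPrinted.towerBonds_inner_of_printTower`), so an interior shell gauge mode passes all typed hypotheses (dag-n05-c's certificates
p572834 ∕ p576185 ∕ p578369: print's class carries the crossing datum that kills the mode).  Typed Prop. 3 is thus STRONGER than print's, and the N05 slot of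
record `Node00.B8LeafOfRecordSubBH θ λ` is EMPTY as typed.  The repair of record (plan g78 WORDS l.24332 ∕ l.24376; dag-n05-d RESULT l.24584 (2)) is a
CARRIER edition, additive: `C137` (the one (1.42)-class reader among the `GFData` letters) re-read over print's class `towerBondsP` (dag-n05-d D0, p582555).
Because `B8.Thm4Printed` ∕ `B8.Thm2Printed` (`B8.lean` :140–168) CONCLUDE `C137 α₁` with THE SAME `α₁` as their HYPOTHESIS `avgClose166 α₁` ∕ `avgClose α₁`, and
the only producer of (1.42) at a crossing bond (r05's `B8Eq131CubesAdmissible.norm_Qj_lt_crossing_loc` inside dag-n05-e's `B8Eq142KLevelLocalGamma.H42_of_inAx_γ`)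
reads (1.35) AT THAT BOND — print p. 82 «|B| < 2dLα₁ … by the assumption (1.35)», (1.35) stated «on Λ_j» in the p. 77 one-end-point class, which CONTAINS the crossing
bond — the (1.35) ∕ (1.66) letters must move together with `C137`: in the box form they do not cover the crossing bonds (n05-w2's bridge `B8Ineq166OneLevelUp`,
p584176, recovers them only at `26384(d+1)L·α₁`, good for the existence conclusions, not for `C137 α₁`), so Theorem 4 ∕ Theorem 2 on a «`C137` wide, (1.35)
box-form» carrier would be stronger than print and underivable (n05-w2 OBJECTION-ZD3P, cell bus 2026-08-27 23:32Z, accepted by this seat and folded here).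
The γ D-chain (D3 Prop. 3 on n05-w1's `B8Prop3KLevelGamma.prop3_kLevel_γ`, D4 Thm 4 on dag-n05-e's γ driver `B8Thm4KLevelGamma` + n05-w2's bridge
`B8Ineq166OneLevelUp`, D5 Thm 2, D6 the leaf knits, D7 the Thm-8 source chain, D9 the univ knits) then targets THIS carrier, and NODE 00 re-pins the slot
(`Node00/CarriersB8SubBP.lean`: `famB8OfRecordSubBP := zdGF3HP ∘ val`, `B8LeafOfRecordSubBP`, `PrintedCarriersR.withB8OfRecordSubBP` — node00-def's, not
this file's).  An in-place edit of `zdGF3` is not fileable (the certificates import it), hence the sibling definitions here — letter for letter n05-c g5's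
`B8LeafModelZd3H` pattern.

## WHAT IS DECLARED ∕ PROVED (kernel, 0 sorry; axioms `propext` ∕ `Classical.choice` ∕ `Quot.sound`)

* §0 `EndBlockIn L Ω j z μ` — print's p. 77 convention for a level-`j` bond `⟨z, z + e_μ⟩` read on the fine lattice: «`Bʲ(z) ⊂ Ω` or `Bʲ(z + e_μ) ⊂ Ω`» (blocks as
  the boxes `[tlo L z j, thi L z j]` of `B8Ineq130`); `endBlockIn_of_box` (the tree's box form «`[loK, bondHiK] ⊂ Ω`» implies it).
* §1 **`zdGF3P 𝔸 L β len i`** := `{ zdGF3 𝔸 L β len i with avgClose := …, avgClose166 := …, C137 := … }` — (1.35) ∕ (1.66) guarded by `EndBlockIn L (i.Ω j) j z μ`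
  ((1.66)₀'s side clause on `SideTouches (i.Ω 0)` verbatim), (1.37) ∕ (1.42) over `towerBondsP L i.Ω (i.Λs i.k) j` — and the `rfl` faces: `zdGF3P_C137` ∕ `_avgClose` ∕
  `_avgClose166` (the new letters) with `_iff` unfoldings, and `zdGF3P_Cfg ∕ _Pert ∕ _GT ∕ _Src ∕ _k ∕ _InA ∕ _Reg335 ∕ _InAAx ∕ _Restricted ∕ _act ∕ _C136 ∕ _Landau ∕ _C139 ∕
  _C162 ∕ _fNorm ∕ _LandauF ∕ _InAPair ∕ _fGrad ∕ _C140 ∕ _InR` (each `= zdGF3`'s).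
* §2 **`zdGF3HP 𝔸 L β len i`** := `{ zdGF3P 𝔸 L β len i with InR := (zdGF3H 𝔸 L β len i).InR }` (Theorem 8's «`f ∈ R(U₀)`» as printed: `InR138 ∧` Hermitian `∧` supported
  in `Ω₀ ∧ Bdd`), `zdGF3HP_toGFData2 : (zdGF3HP …).toGFData2 = (zdGF3P …).toGFData2` (`rfl`), `zdGF3HP_InR`, `zdGF3HP_C140`, `inR_zdGF3HP_iff`, `zdGF3HP_C137`.
* §3 THE HONEST REMARKS, NEW ⇒ OLD (no converses): `zdGF3P_C137_imp` (`i.Λb i.k j ⊆ towerBondsP L i.Ω (i.Λs i.k) j`, `B8TowerBondsPrinted.ZdIdx.lamB_subset_towerBondsP`),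
  `zdGF3P_avgClose_imp`, `zdGF3P_avgClose166_imp` (`endBlockIn_of_box`), `zdGF3HP_C137_imp`.  Non-vacuity bookkeeping: `zdGF3P_C137_of_forall`, `zdGF3P_avgClose_of_forall`
  (bounds on ALL level-`j` bonds give the letters — e.g. `U′ = 1`, `A = 0`).

## HONEST SCOPE

(i) One pair of additive carrier definitions + one auxiliary predicate + `rfl` ∕ one-implication bookkeeping; NO estimate; nothing of [Balaban1985RegularSpaces] is
asserted.  (ii) The P-carrier is PRINT-FAITHFUL in its four class-sensitive letters: (1.37) ∕ (1.42) over `towerBondsP` = (1.31)'s ∕ [B6] (2.3)'s class (inner AND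
crossing bonds; box law «inner: box ⊂ Ω_j, crossing: box ⊂ Ω_{j−1}»); (1.35) «on Λ_j» ⊂ (1.66) ∕ (1.145) «on Ω_j^{(j)}» in the p. 77 one-end-point class (`Λ_j ⊂
Ω_j^{(j)}` (1.5); the carrier states the Ω_j^{(j)} form for all three, as `zdGF3` did in the box form).  (iii) VARIANCES (why all three move together, and what does NOT
transfer): `C137` and `avgClose` each sit on BOTH sides in `B8.lean` ∕ `B8SectGH.lean` — `C137`: conclusion of Thm 2 ∕ Thm 4 ∕ Thm 8's existence clauses, hypothesis
of Prop. 3 and of the uniqueness clauses; `avgClose(166)`: hypothesis of Thm 2 ∕ Thm 4 ∕ Thm 8, conclusion (1.145) of Prop. 7 (`B8SectGH.Prop7PrintedR … ∧ avgClose (2α₂) …`).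
Hence NO transfer «X at `zdGF3` ⇒ X at `zdGF3P`» holds by `rfl` or is claimed for t2 ∕ p3 ∕ t4 ∕ p7 ∕ t8; the NEW letters IMPLY the old ones (§3), so hypothesis-side
uses of the old letters are served by one line, conclusion-side ones are not (the landed Prop-7 ∕ `toAxial` instances live on the admitted-torus family, where every
guard is trivial).  Whether t2 ∕ p3 ∕ t4 ∕ t8 hold on `zdGF3P` is the γ D-chain's content (D3 n05-d on `prop3_kLevel_γ`; D4 n05-w2: existence by dag-n05-e's γ driver
fed through p584176 — the one-end-point letter implies the box form the bridge consumes —, `C137 α₁` wide by the (1.42) lemma with the one-end-point guard on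
`h135`, n05-w2's `B8Eq142KLevelLocalGammaPrime`; D5 ∕ D6 ∕ D7 ∕ D9), not this file's.  Lemma 1's carriers, (1.140) (Prop. 7's hypothesis) and Theorem 8's `InR` ∕
`LandauF` ∕ `fNorm` ∕ `fGrad` are untouched (`rfl`).  (iv) History: dag-n05-d's hand (l.24729) specified `C137` only; n05-w2's OBJECTION-ZD3P (l.24816) located the
same-`α₁` coupling above; this seat adopted n05-w2's block-wise one-end-point text (NOT the earlier «box ⊂ Ω_{j−1}» proposal, which over-asks on collar bonds).  (v) This letter discharges
nothing by itself: the OLD slot is EMPTY as typed (p585094); the NEW slot and the record re-pin are NODE 00's.  Count-neutral; N05 NOT discharged; no count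
claim; `T_η ↦ ℤᵈ`, `G = U(𝔸)`; one finite `𝕋⁴` programme at fixed `ε`, Bałaban AS PRINTED; the Yang–Mills mass gap (Clay) is NOT proved by any of this —
R4 closes the conditional finite-`𝕋⁴` rung `BalabanLadder.UV` only; nothing continuum ∕ ℝ⁴ ∕ OS.  No `sorry`, no `instance`, no `notation`.  Unit
`pub-ymgap-dag-n05-w1` (g0), 2026-08-27.

RELATED IN THE TREE, NOT DUPLICATED: `B8LeafModelZd3.zdGF3` (n05-a; the base, USED), `B8LeafModelZd3H.zdGF3H` (n05-c g5; the `InR` reading, USED), `B8TowerBondsPrinted`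
(dag-n05-d D0: `towerBondsP`, `ZdIdx.lamB_subset_towerBondsP`, `ZdIdx.towerBondsP_laws`, USED), `B8Prop3ShellModeVacuity` (dag-n05-d: why), `Node00.CarriersB8SubBH`
(the old pin; its P-twin is NODE 00's).

[cite: Balaban1985RegularSpaces, (1.31) p.82, (1.37) p.82, (1.42) p.83, (1.12) p.78, p.77, (1.4)–(1.5) p.77, (1.35) p.82, (1.66) p.88, (1.145) p.100, Thm 8 (1.146) p.101;
Balaban1984PropagatorsII, (2.3) p.224]
-/

noncomputable section

open NormedSpace

namespace Literature.MathematicalPhysics.QuantumFieldTheory.Balaban1983to89.B8LeafModelZd3P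

open B7Prop1Explicit (e)
open B7Prop1Local (InBox loK bondHiK)
open B7Prop2Explicit (unitaryUnits avgIter)
open B7Prop4GeneralLevels (logCovIter)
open B8Lemma1NonAbelian (mulCfg)
open B8Eq140Level (SideTouches)
open B8Ineq130 (tlo thi tlo_apply thi_apply)
open B8Eq146AExpansion (iEta)
open B8LeafModelZd (ZdIdx)
open B8LeafModelZd3 (zdGF3 mlogCfg)
open B8LeafModelZd3H (zdGF3H)
open B8TowerBondsPrinted (towerBondsP)

-- `Site` alone could resolve to the torus sites of `Setup.lean`; re-export the `ℤ^d` sites of `B7Prop1Explicit`.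
export B7Prop1Explicit (Site)

variable {d : ℕ}

/-! ## §0 Print's p. 77 bond convention on the `j`-lattice, read on the fine lattice: one end-block in `Ω` -/

/-- **«at least one end-point of the bond `⟨z, z + e_μ⟩` of the `j`-lattice belongs to `Ω^{(j)}`»** (p. 77 convention, «applies to an arbitrary lattice»), read on
the fine lattice through `Ω_j = Bʲ(Ω_j^{(j)})` ((1.4)): the `Lʲ`-block `Bʲ(z) = [Lʲz, Lʲ(z + 𝟙) − 𝟙]` (`B8Ineq130.tlo ∕ thi`) of `z` OR that of `z + e_μ` lies in `Ω`.
The guard of the re-typed (1.35) ∕ (1.66) letters. [cite: Balaban1985RegularSpaces, p.77 (convention before (1.5)), (1.4) p.77, (1.35) p.82] -/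
def EndBlockIn (L : ℕ) (Ω : Set (Site d)) (j : ℕ) (z : Site d) (μ : Fin d) : Prop :=
  (∀ x, InBox (tlo L z j) (thi L z j) x → x ∈ Ω) ∨ (∀ x, InBox (tlo L (z + e μ) j) (thi L (z + e μ) j) x → x ∈ Ω)

/-- Unfolding `EndBlockIn` (`Iff.rfl`). [cite: Balaban1985RegularSpaces, p.77 (convention before (1.5))] -/
theorem endBlockIn_iff (L : ℕ) (Ω : Set (Site d)) (j : ℕ) (z : Site d) (μ : Fin d) :
    EndBlockIn L Ω j z μ ↔
      (∀ x, InBox (tlo L z j) (thi L z j) x → x ∈ Ω) ∨ (∀ x, InBox (tlo L (z + e μ) j) (thi L (z + e μ) j) x → x ∈ Ω) :=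
  Iff.rfl

/-- Both end-blocks lie in the two-block box `[loK L j z, bondHiK L j z μ] = Bʲ(z) ∪ Bʲ(z + e_μ)` of [3] p. 24: the first block.
[cite: Balaban1985Averaging, p.24 (locality sentence after (43))] -/
theorem inBox_loK_bondHiK_of_inBox_block (L j : ℕ) (z : Site d) (μ : Fin d) {x : Site d} (hx : InBox (tlo L z j) (thi L z j) x) :
    InBox (loK L j z) (bondHiK L j z μ) x := by
  intro i
  obtain ⟨h1, h2⟩ := hx i
  rw [tlo_apply] at h1
  rw [thi_apply] at h2
  have hP : (0 : ℤ) ≤ (L : ℤ) ^ j := by positivity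
  simp only [loK, bondHiK]
  refine ⟨h1, ?_⟩
  split_ifs <;> nlinarith

/-- The second block `Bʲ(z + e_μ)` lies in the two-block box as well. [cite: Balaban1985Averaging, p.24 (locality sentence after (43))] -/
theorem inBox_loK_bondHiK_of_inBox_block_add (L j : ℕ) (z : Site d) (μ : Fin d) {x : Site d}
    (hx : InBox (tlo L (z + e μ) j) (thi L (z + e μ) j) x) : InBox (loK L j z) (bondHiK L j z μ) x := by
  intro i
  obtain ⟨h1, h2⟩ := hx i
  rw [tlo_apply] at h1
  rw [thi_apply] at h2
  have hP : (0 : ℤ) ≤ (L : ℤ) ^ j := by positivity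
  simp only [loK, bondHiK]
  by_cases hi : i = μ
  · subst hi
    simp only [Pi.add_apply, e, Pi.single_eq_same] at h1 h2
    rw [if_pos rfl]
    constructor <;> nlinarith
  · simp only [Pi.add_apply, e, Pi.single_eq_of_ne hi, add_zero] at h1 h2
    rw [if_neg hi]
    constructor <;> nlinarith

/-- **THE TREE's BOX FORM IMPLIES PRINT's ONE-END-POINT FORM** of a guard: if the whole two-block box of `⟨z, z + e_μ⟩` lies in `Ω`, then (in particular) its
first end-block does. [cite: Balaban1985RegularSpaces, p.77 (convention before (1.5)); Balaban1985Averaging, p.24] -/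
theorem endBlockIn_of_box (L : ℕ) (Ω : Set (Site d)) (j : ℕ) (z : Site d) (μ : Fin d)
    (h : ∀ x, InBox (loK L j z) (bondHiK L j z μ) x → x ∈ Ω) : EndBlockIn L Ω j z μ :=
  Or.inl fun x hx => h x (inBox_loK_bondHiK_of_inBox_block L j z μ hx)

/-! ## §1 The P-carrier `zdGF3P`: (1.35) ∕ (1.66) in the one-end-point class, (1.37) ∕ (1.42) over print's class of the member's own tower; `rfl` faces -/

section Family

variable (𝔸 : Type) [CStarAlgebra 𝔸] (L : ℕ) (β : ℝ) (len : Site d → ℝ)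

/-- **NODE 00's [B8] member with its class-sensitive letters read as printed**: n05-a's `zdGF3 𝔸 L β len i` with (1.35) `avgClose` ∕ (1.66) `avgClose166` guarded by
print's p. 77 one-end-point class `EndBlockIn L (i.Ω j) j z μ` («on Λ_j» ∕ «on Ω_j^{(j)}» — every `j`-bond with an end-point in `Ω_j^{(j)}`; the (1.66)₀ side clause on the
sides of the plaquettes touching `Ω₀` verbatim), and the (1.37) ∕ (1.42) letter `C137` replaced by «`‖Q_j(U₀, iη·A)(c)‖ < 2dLα₁` for every `j ≤ k` and every
`c ∈ towerBondsP L i.Ω (i.Λs i.k) j`» ((1.31) incl. the crossing contours; [B6] (2.3); `A = mlogCfg i.k i.η i.Ω U₁`, the canonical exponent, as in `zdGF3`); all other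
fields verbatim (hence `rfl`-equal).
[cite: Balaban1985RegularSpaces, (1.35) p.82, (1.66) p.88, (1.37) p.82, (1.42) p.83, (1.31) p.82, p.77; Balaban1984PropagatorsII, (2.3) p.224] -/
def zdGF3P (i : ZdIdx d L) : B8SectGH.GFData3 :=
  { zdGF3 𝔸 L β len i with
    avgClose := fun α U₀ P => ∀ j, j ≤ i.k → ∀ (z : Site d) (μ : Fin d), EndBlockIn L (i.Ω j) j z μ →
      ‖(avgIter L (mulCfg P.2.1 U₀.1) j z μ : 𝔸) - (avgIter L U₀.1 j z μ : 𝔸)‖ ≤ α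
    avgClose166 := fun α U₀ P =>
      (∀ j, j ≤ i.k → ∀ (z : Site d) (μ : Fin d), EndBlockIn L (i.Ω j) j z μ →
        ‖(avgIter L (mulCfg P.2.1 U₀.1) j z μ : 𝔸) - (avgIter L U₀.1 j z μ : 𝔸)‖ ≤ α) ∧
      ∀ b ∈ {b : Site d × Fin d | SideTouches (i.Ω 0) b.1 b.2}, ‖((P.2.1 b.1 b.2 : 𝔸ˣ) : 𝔸) - 1‖ ≤ α
    C137 := fun α₁ U₀ P => ∀ j, j ≤ i.k → ∀ c ∈ towerBondsP L i.Ω (i.Λs i.k) j,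
      ‖logCovIter L U₀.1 (iEta i.η (mlogCfg i.k i.η i.Ω P.2.1)) j c.1 c.2‖ < 2 * d * L * α₁ }

variable {𝔸 L β len}

/-- **The new (1.35) letter, unfolded** (`Iff.rfl`): «|Ū′U₀ʲ(b) − Ū₀ʲ(b)| ≤ α at every `j`-bond `b` with an end-point in Ω_j^{(j)}», `j ≤ k`.
[cite: Balaban1985RegularSpaces, (1.35) p.82, p.77] -/
theorem zdGF3P_avgClose_iff (i : ZdIdx d L) (α : ℝ) (U₀ : (zdGF3P 𝔸 L β len i).Cfg) (P : (zdGF3P 𝔸 L β len i).Pert) :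
    (zdGF3P 𝔸 L β len i).avgClose α U₀ P ↔ ∀ j, j ≤ i.k → ∀ (z : Site d) (μ : Fin d), EndBlockIn L (i.Ω j) j z μ →
      ‖(avgIter L (mulCfg P.2.1 U₀.1) j z μ : 𝔸) - (avgIter L U₀.1 j z μ : 𝔸)‖ ≤ α :=
  Iff.rfl

/-- **The new (1.66) letter, unfolded** (`Iff.rfl`): the (1.35)-shape clause in the one-end-point class `∧` the (1.66)₀ side clause «|U′ − 1| ≤ α on the sides of the
plaquettes touching Ω₀». [cite: Balaban1985RegularSpaces, (1.66) p.88, p.77] -/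
theorem zdGF3P_avgClose166_iff (i : ZdIdx d L) (α : ℝ) (U₀ : (zdGF3P 𝔸 L β len i).Cfg) (P : (zdGF3P 𝔸 L β len i).Pert) :
    (zdGF3P 𝔸 L β len i).avgClose166 α U₀ P ↔
      (∀ j, j ≤ i.k → ∀ (z : Site d) (μ : Fin d), EndBlockIn L (i.Ω j) j z μ →
        ‖(avgIter L (mulCfg P.2.1 U₀.1) j z μ : 𝔸) - (avgIter L U₀.1 j z μ : 𝔸)‖ ≤ α) ∧
      ∀ b ∈ {b : Site d × Fin d | SideTouches (i.Ω 0) b.1 b.2}, ‖((P.2.1 b.1 b.2 : 𝔸ˣ) : 𝔸) - 1‖ ≤ α :=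
  Iff.rfl

/-- **The new letter, unfolded** (`rfl`): (1.37) ∕ (1.42) over print's class `towerBondsP` of the member's tower at the top truncation.
[cite: Balaban1985RegularSpaces, (1.37) p.82, (1.42) p.83, (1.31) p.82] -/
theorem zdGF3P_C137 (i : ZdIdx d L) :
    (zdGF3P 𝔸 L β len i).C137 = fun α₁ U₀ P => ∀ j, j ≤ i.k → ∀ c ∈ towerBondsP L i.Ω (i.Λs i.k) j,
      ‖logCovIter L U₀.1 (iEta i.η (mlogCfg i.k i.η i.Ω P.2.1)) j c.1 c.2‖ < 2 * d * L * α₁ :=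
  rfl

/-- The new letter at given data, as an `Iff` (`Iff.rfl`). [cite: Balaban1985RegularSpaces, (1.37) p.82, (1.42) p.83] -/
theorem zdGF3P_C137_iff (i : ZdIdx d L) (α₁ : ℝ) (U₀ : (zdGF3P 𝔸 L β len i).Cfg) (P : (zdGF3P 𝔸 L β len i).Pert) :
    (zdGF3P 𝔸 L β len i).C137 α₁ U₀ P ↔ ∀ j, j ≤ i.k → ∀ c ∈ towerBondsP L i.Ω (i.Λs i.k) j,
      ‖logCovIter L U₀.1 (iEta i.η (mlogCfg i.k i.η i.Ω P.2.1)) j c.1 c.2‖ < 2 * d * L * α₁ :=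
  Iff.rfl

/-- The carriers are unchanged: `Cfg` (`rfl`). [cite: Balaban1985RegularSpaces, (1.33) p.82 (bookkeeping)] -/
theorem zdGF3P_Cfg (i : ZdIdx d L) : (zdGF3P 𝔸 L β len i).Cfg = (zdGF3 𝔸 L β len i).Cfg := rfl

/-- `Pert` unchanged (`rfl`). [cite: Balaban1985RegularSpaces, (1.34) p.82 (bookkeeping)] -/
theorem zdGF3P_Pert (i : ZdIdx d L) : (zdGF3P 𝔸 L β len i).Pert = (zdGF3 𝔸 L β len i).Pert := rfl

/-- `GT` unchanged (`rfl`). [cite: Balaban1985RegularSpaces, (1.29) p.81 (bookkeeping)] -/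
theorem zdGF3P_GT (i : ZdIdx d L) : (zdGF3P 𝔸 L β len i).GT = (zdGF3 𝔸 L β len i).GT := rfl

/-- `Src` unchanged (`rfl`). [cite: Balaban1985RegularSpaces, (1.146) p.101 (bookkeeping)] -/
theorem zdGF3P_Src (i : ZdIdx d L) : (zdGF3P 𝔸 L β len i).Src = (zdGF3 𝔸 L β len i).Src := rfl

/-- `k` unchanged (`rfl`). [cite: Balaban1985RegularSpaces, (1.3) p.77 (bookkeeping)] -/
theorem zdGF3P_k (i : ZdIdx d L) : (zdGF3P 𝔸 L β len i).k = (zdGF3 𝔸 L β len i).k := rfl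

/-- (1.33) `InA` unchanged (`rfl`). [cite: Balaban1985RegularSpaces, (1.33) p.82 (bookkeeping)] -/
theorem zdGF3P_InA (i : ZdIdx d L) : (zdGF3P 𝔸 L β len i).InA = (zdGF3 𝔸 L β len i).InA := rfl

/-- `Reg335` unchanged (`rfl`). [cite: Balaban1985RegularSpaces, (1.40) p.83 (bookkeeping)] -/
theorem zdGF3P_Reg335 (i : ZdIdx d L) : (zdGF3P 𝔸 L β len i).Reg335 = (zdGF3 𝔸 L β len i).Reg335 := rfl

/-- (1.34) `InAAx` unchanged (`rfl`). [cite: Balaban1985RegularSpaces, (1.34) p.82 (bookkeeping)] -/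
theorem zdGF3P_InAAx (i : ZdIdx d L) : (zdGF3P 𝔸 L β len i).InAAx = (zdGF3 𝔸 L β len i).InAAx := rfl

/-- (1.29) `Restricted` unchanged (`rfl`). [cite: Balaban1985RegularSpaces, (1.29) p.81 (bookkeeping)] -/
theorem zdGF3P_Restricted (i : ZdIdx d L) : (zdGF3P 𝔸 L β len i).Restricted = (zdGF3 𝔸 L β len i).Restricted := rfl

/-- The gauge action `act` unchanged (`rfl`). [cite: Balaban1985RegularSpaces, (1.29) p.81 (bookkeeping)] -/
theorem zdGF3P_act (i : ZdIdx d L) : (zdGF3P 𝔸 L β len i).act = (zdGF3 𝔸 L β len i).act := rfl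

/-- (1.36) `C136` unchanged (`rfl`). [cite: Balaban1985RegularSpaces, (1.36) p.82 (bookkeeping)] -/
theorem zdGF3P_C136 (i : ZdIdx d L) : (zdGF3P 𝔸 L β len i).C136 = (zdGF3 𝔸 L β len i).C136 := rfl

/-- (1.38) `Landau` unchanged (`rfl`). [cite: Balaban1985RegularSpaces, (1.38) p.82 (bookkeeping)] -/
theorem zdGF3P_Landau (i : ZdIdx d L) : (zdGF3P 𝔸 L β len i).Landau = (zdGF3 𝔸 L β len i).Landau := rfl

/-- (1.39) `C139` unchanged (`rfl`). [cite: Balaban1985RegularSpaces, (1.39) p.82 (bookkeeping)] -/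
theorem zdGF3P_C139 (i : ZdIdx d L) : (zdGF3P 𝔸 L β len i).C139 = (zdGF3 𝔸 L β len i).C139 := rfl

/-- (1.62) `C162` unchanged (`rfl`). [cite: Balaban1985RegularSpaces, (1.62) p.87 (bookkeeping)] -/
theorem zdGF3P_C162 (i : ZdIdx d L) : (zdGF3P 𝔸 L β len i).C162 = (zdGF3 𝔸 L β len i).C162 := rfl

/-- `|f|₍₋₂₎` unchanged (`rfl`). [cite: Balaban1985RegularSpaces, p.86 (definition after (1.55)) (bookkeeping)] -/
theorem zdGF3P_fNorm (i : ZdIdx d L) : (zdGF3P 𝔸 L β len i).fNorm = (zdGF3 𝔸 L β len i).fNorm := rfl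

/-- (1.146) `LandauF` unchanged (`rfl`). [cite: Balaban1985RegularSpaces, (1.146) p.101 (bookkeeping)] -/
theorem zdGF3P_LandauF (i : ZdIdx d L) : (zdGF3P 𝔸 L β len i).LandauF = (zdGF3 𝔸 L β len i).LandauF := rfl

/-- (1.40)₂ `InAPair` unchanged (`rfl`). [cite: Balaban1985RegularSpaces, (1.40) p.83 (bookkeeping)] -/
theorem zdGF3P_InAPair (i : ZdIdx d L) : (zdGF3P 𝔸 L β len i).InAPair = (zdGF3 𝔸 L β len i).InAPair := rfl

/-- `|D f|₍₋₃₎` unchanged (`rfl`). [cite: Balaban1985RegularSpaces, p.86 (definition after (1.55)) (bookkeeping)] -/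
theorem zdGF3P_fGrad (i : ZdIdx d L) : (zdGF3P 𝔸 L β len i).fGrad = (zdGF3 𝔸 L β len i).fGrad := rfl

/-- (1.140) `C140` unchanged (`rfl`). [cite: Balaban1985RegularSpaces, (1.140) p.100 (bookkeeping)] -/
theorem zdGF3P_C140 (i : ZdIdx d L) : (zdGF3P 𝔸 L β len i).C140 = (zdGF3 𝔸 L β len i).C140 := rfl

/-- Theorem 8's `InR` unchanged w.r.t. `zdGF3` (`rfl`; the printed reading is `zdGF3HP`'s, §2). [cite: Balaban1985RegularSpaces, (1.146) p.101 (bookkeeping)] -/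
theorem zdGF3P_InR (i : ZdIdx d L) : (zdGF3P 𝔸 L β len i).InR = (zdGF3 𝔸 L β len i).InR := rfl

end Family

/-! ## §2 The P-carrier with Theorem 8's source space as printed: `zdGF3HP` -/

section FamilyH

variable (𝔸 : Type) [CStarAlgebra 𝔸] (L : ℕ) (β : ℝ) (len : Site d → ℝ)

/-- **The P-carrier with Theorem 8's «`f ∈ R(U₀)`» read as printed** (n05-c g5's `zdGF3H` reading: `InR138 ∧` Lie-algebra valued `∧` supported in `Ω₀ ∧` finite
`|f|₍₋₂₎`): `zdGF3P` with the ONE field `InR` replaced by `zdGF3H`'s — the carrier NODE 00's P-pin `famB8OfRecordSubBP` is to read.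
[cite: Balaban1985RegularSpaces, Thm 8 (1.146) p.101, (1.37) p.82, (1.31) p.82] -/
def zdGF3HP (i : ZdIdx d L) : B8SectGH.GFData3 :=
  { zdGF3P 𝔸 L β len i with InR := (zdGF3H 𝔸 L β len i).InR }

variable {𝔸 L β len}

/-- The `GFData2` part (Lemma 1 – Prop. 6 letters, incl. the NEW `C137`) of `zdGF3HP` IS `zdGF3P`'s (`rfl`). [cite: Balaban1985RegularSpaces, (1.33)–(1.40) pp.82–83 (bookkeeping)] -/
theorem zdGF3HP_toGFData2 (i : ZdIdx d L) : (zdGF3HP 𝔸 L β len i).toGFData2 = (zdGF3P 𝔸 L β len i).toGFData2 := rfl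

/-- The `GFData` part of `zdGF3HP` IS `zdGF3P`'s (`rfl`). [cite: Balaban1985RegularSpaces, (1.33)–(1.39) p.82 (bookkeeping)] -/
theorem zdGF3HP_toGFData (i : ZdIdx d L) : (zdGF3HP 𝔸 L β len i).toGFData = (zdGF3P 𝔸 L β len i).toGFData := rfl

/-- Theorem 8's `InR` of `zdGF3HP` IS `zdGF3H`'s four-clause reading (`rfl`). [cite: Balaban1985RegularSpaces, Thm 8 (1.146) p.101 (bookkeeping)] -/
theorem zdGF3HP_InR (i : ZdIdx d L) : (zdGF3HP 𝔸 L β len i).InR = (zdGF3H 𝔸 L β len i).InR := rfl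

/-- (1.140) of `zdGF3HP` IS `zdGF3`'s (`rfl`). [cite: Balaban1985RegularSpaces, (1.140) p.100 (bookkeeping)] -/
theorem zdGF3HP_C140 (i : ZdIdx d L) : (zdGF3HP 𝔸 L β len i).C140 = (zdGF3 𝔸 L β len i).C140 := rfl

/-- The NEW (1.37) ∕ (1.42) letter on `zdGF3HP` (`rfl`). [cite: Balaban1985RegularSpaces, (1.37) p.82, (1.42) p.83, (1.31) p.82] -/
theorem zdGF3HP_C137 (i : ZdIdx d L) : (zdGF3HP 𝔸 L β len i).C137 = (zdGF3P 𝔸 L β len i).C137 := rfl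

/-- The NEW (1.35) letter on `zdGF3HP` (`rfl`). [cite: Balaban1985RegularSpaces, (1.35) p.82, p.77] -/
theorem zdGF3HP_avgClose (i : ZdIdx d L) : (zdGF3HP 𝔸 L β len i).avgClose = (zdGF3P 𝔸 L β len i).avgClose := rfl

/-- The NEW (1.66) letter on `zdGF3HP` (`rfl`). [cite: Balaban1985RegularSpaces, (1.66) p.88, p.77] -/
theorem zdGF3HP_avgClose166 (i : ZdIdx d L) : (zdGF3HP 𝔸 L β len i).avgClose166 = (zdGF3P 𝔸 L β len i).avgClose166 := rfl

/-- **The four clauses of `zdGF3HP`'s «`f ∈ R(U₀)`»** (unfolding; = `B8LeafModelZd3H.inR_zdGF3H_iff`). [cite: Balaban1985RegularSpaces, Thm 8 (1.146) p.101, (1.27) p.80, p.86] -/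
theorem inR_zdGF3HP_iff (i : ZdIdx d L) (U₀ : (zdGF3HP 𝔸 L β len i).Cfg) (f : Site d → 𝔸) :
    (zdGF3HP 𝔸 L β len i).InR U₀ f ↔
      B8Eq138LandauZd.InR138 L i.k i.η (i.Ω 0) (i.Λs i.k) U₀.1 f ∧ (∀ x, IsSelfAdjoint (f x)) ∧ (∀ x, x ∉ i.Ω 0 → f x = 0) ∧
        B8ScaledSupNorm.Bdd L i.k i.η (-(2 : ℝ)) (fun j (x : Site d) => x ∈ i.Ω j) f :=
  Iff.rfl

end FamilyH

/-! ## §3 The honest remarks: each NEW letter implies the OLD one (no converses) -/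

section Remark

variable {𝔸 : Type} [CStarAlgebra 𝔸] {L : ℕ} {β : ℝ} {len : Site d → ℝ}

/-- **NEW ⇒ OLD for the (1.37) ∕ (1.42) letter**: print's class of the member's tower CONTAINS the member's law class (`i.Λb i.k j ⊆ towerBondsP L i.Ω (i.Λs i.k) j`
for `j ≤ i.k`, dag-n05-d's `B8TowerBondsPrinted.ZdIdx.lamB_subset_towerBondsP`), so the bound over the larger class gives the bound over the smaller.  NO converse
(the crossing bonds are exactly what `i.Λb` misses) — and no transfer of Thm 4 ∕ Prop 3 ∕ Thm 2 between the carriers is claimed (`C137` in both variances).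
[cite: Balaban1985RegularSpaces, (1.31) p.82, (1.37) p.82, (1.12) p.78] -/
theorem zdGF3P_C137_imp (i : ZdIdx d L) {α₁ : ℝ} {U₀ : (zdGF3P 𝔸 L β len i).Cfg} {P : (zdGF3P 𝔸 L β len i).Pert}
    (h : (zdGF3P 𝔸 L β len i).C137 α₁ U₀ P) : (zdGF3 𝔸 L β len i).C137 α₁ U₀ P :=
  fun j hj c hc => h j hj c (B8TowerBondsPrinted.ZdIdx.lamB_subset_towerBondsP i i.k le_rfl j hj hc)

/-- The same remark for `zdGF3HP` against `zdGF3H` (whose `C137` is `zdGF3`'s). [cite: Balaban1985RegularSpaces, (1.31) p.82, (1.37) p.82] -/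
theorem zdGF3HP_C137_imp (i : ZdIdx d L) {α₁ : ℝ} {U₀ : (zdGF3HP 𝔸 L β len i).Cfg} {P : (zdGF3HP 𝔸 L β len i).Pert}
    (h : (zdGF3HP 𝔸 L β len i).C137 α₁ U₀ P) : (zdGF3H 𝔸 L β len i).C137 α₁ U₀ P :=
  zdGF3P_C137_imp i h

/-- **NEW ⇒ OLD for the (1.35) letter**: the one-end-point class CONTAINS the box-form class (if the whole two-block box of `⟨z, z + e_μ⟩` lies in `Ω_j`, its first
end-block does — `endBlockIn_of_box`), so `zdGF3P`'s (1.35) letter implies `zdGF3`'s.  NO converse (the crossing ∕ boundary bonds of `Ω_j^{(j)}` are exactly what the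
box form misses). [cite: Balaban1985RegularSpaces, (1.35) p.82, p.77] -/
theorem zdGF3P_avgClose_imp (i : ZdIdx d L) {α : ℝ} {U₀ : (zdGF3P 𝔸 L β len i).Cfg} {P : (zdGF3P 𝔸 L β len i).Pert}
    (h : (zdGF3P 𝔸 L β len i).avgClose α U₀ P) : (zdGF3 𝔸 L β len i).avgClose α U₀ P :=
  fun j hj z μ hbox => h j hj z μ (endBlockIn_of_box L (i.Ω j) j z μ hbox)

/-- **NEW ⇒ OLD for the (1.66) letter** (the (1.35)-shape clause by `endBlockIn_of_box`, the (1.66)₀ side clause verbatim). [cite: Balaban1985RegularSpaces, (1.66) p.88, p.77] -/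
theorem zdGF3P_avgClose166_imp (i : ZdIdx d L) {α : ℝ} {U₀ : (zdGF3P 𝔸 L β len i).Cfg} {P : (zdGF3P 𝔸 L β len i).Pert}
    (h : (zdGF3P 𝔸 L β len i).avgClose166 α U₀ P) : (zdGF3 𝔸 L β len i).avgClose166 α U₀ P :=
  ⟨fun j hj z μ hbox => h.1 j hj z μ (endBlockIn_of_box L (i.Ω j) j z μ hbox), h.2⟩

/-- The same two remarks for `zdGF3HP` against `zdGF3H` (whose letters are `zdGF3`'s). [cite: Balaban1985RegularSpaces, (1.35) p.82, (1.66) p.88] -/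
theorem zdGF3HP_avgClose166_imp (i : ZdIdx d L) {α : ℝ} {U₀ : (zdGF3HP 𝔸 L β len i).Cfg} {P : (zdGF3HP 𝔸 L β len i).Pert}
    (h : (zdGF3HP 𝔸 L β len i).avgClose166 α U₀ P) : (zdGF3H 𝔸 L β len i).avgClose166 α U₀ P :=
  zdGF3P_avgClose166_imp i h

/-- **Non-vacuity bookkeeping, (1.35)**: a bound at ALL `j`-bonds, `j ≤ k` (e.g. `U′ = 1`), gives the new (1.35) letter. [cite: Balaban1985RegularSpaces, (1.35) p.82 (bookkeeping)] -/
theorem zdGF3P_avgClose_of_forall (i : ZdIdx d L) {α : ℝ} {U₀ : (zdGF3P 𝔸 L β len i).Cfg} {P : (zdGF3P 𝔸 L β len i).Pert}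
    (h : ∀ j, j ≤ i.k → ∀ (z : Site d) (μ : Fin d), ‖(avgIter L (mulCfg P.2.1 U₀.1) j z μ : 𝔸) - (avgIter L U₀.1 j z μ : 𝔸)‖ ≤ α) :
    (zdGF3P 𝔸 L β len i).avgClose α U₀ P :=
  fun j hj z μ _ => h j hj z μ

/-- **Non-vacuity bookkeeping, (1.37)**: a bound on ALL level-`j` bonds, `j ≤ k`, gives the new letter (e.g. at `U₁ = 1`, where `mlogCfg … 1 = 0` and the averages
vanish — the D-chain's witnesses instantiate this). [cite: Balaban1985RegularSpaces, (1.37) p.82 (bookkeeping)] -/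
theorem zdGF3P_C137_of_forall (i : ZdIdx d L) {α₁ : ℝ} {U₀ : (zdGF3P 𝔸 L β len i).Cfg} {P : (zdGF3P 𝔸 L β len i).Pert}
    (h : ∀ j, j ≤ i.k → ∀ c : Site d × Fin d,
      ‖logCovIter L U₀.1 (iEta i.η (mlogCfg i.k i.η i.Ω P.2.1)) j c.1 c.2‖ < 2 * d * L * α₁) :
    (zdGF3P 𝔸 L β len i).C137 α₁ U₀ P :=
  fun j hj c _ => h j hj c

end Remark

#print axioms zdGF3P_C137_imp
#print axioms zdGF3P_avgClose166_imp
#print axioms zdGF3HP_toGFData2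

end Literature.MathematicalPhysics.QuantumFieldTheory.Balaban1983to89.B8LeafModelZd3P

end
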